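import Mathlib
import HarnessLib
import HarnessLib.Audit
import Summits.NavierStokesRegularity.Statement
import Literature.Analysis.FluidPDE.ClassicalSolution
import Literature.Analysis.FluidPDE.LerayHopf
import Literature.Analysis.FluidPDE.SuitableWeak
import Literature.Analysis.FluidPDE.SelfSimilar
import Literature.Analysis.FluidPDE.KochTataru
import Literature.Analysis.FluidPDE.WeakSolution
import Literature.Analysis.FluidPDE.VectorCalculus
import Literature.Analysis.FluidPDE.MildSolution
import Literature.Analysis.FluidPDE.NSWave0
import Summits.NavierStokesRegularity.NavierStokesRegularity.Theorems.TypeICertificateLadderNoBlowupToClay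
import Literature.Analysis.FluidPDE.TypeIAncientMild

/-!
Route: SymmetryModuliCount

DORMANT since 2026-09-04T10:54:32Z (reconciler: no traction for 5 d (last activity statement-claimed at 2026-08-30T10:20:50Z); parked, not closed — `ledger route dormant route-NavierStokesRegularity-SymmetryModuliCount --off` to reactiv) — unstaffed, not closed; items shared with open routes are served there. `ledger route dormant <id> --off` reactivates.

# Route SymmetryModuliCount — NavierStokesRegularity (Clay A), positive side; card
NavierStokesRegularity/NavierStokesRegularity/discrete-stabiliser-dimension-count ("continuous
symmetries are free" = "a symmetry is a free certificate"), rev 6 (promote pass gen 2, 2026-08-16: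
lever C — pressure-blind stretching certificates — folded in as the named attack on the one open
node; its engine filed as support stmt-14340; texts rewritten; sources read with page numbers)

## Thesis X = TypeIAncientLiouville — (L') in the KNSS gauge: it suffices to show
In words: every smooth divergence-free u on ℝ³×(−∞,0) that is a MILD ancient solution in the sense
of Koch–Nadirashvili–Seregin–Šverák (Oseen integral equation from every earlier time: the gauge with
no parasitic b(t) and no Galilean frames; KNSS2009 §1, Seregin2014Notes Def 6.3 p.109) and is Type I
in time, |u(t,x)| ≤ C/√(−t), vanishes identically. A_C := {such u} = {u : IsTypeIAncientMild C u}
(tree; `isTypeIAncientMild_iff` is definitional). A_C is compact in C^∞_loc, invariant under the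
7-dimensional similarity group Sim(3) = ℝ³ ⋊ (ℝ₊ × SO(3)) and under backward time-shifts u ↦ u(·−δ),
δ ≥ 0 (`IsTypeIAncientMild.comp_sub_right`). X ∧ NoTypeII ⇒ Clay (A) by the KNSS §6 zoom
(LiouvilleKillsTypeI, NoBlowupToClay PROVED).
Lean: ∀ (C : ℝ) (u : ℝ → EuclideanSpace ℝ (Fin 3) → EuclideanSpace ℝ (Fin 3)), ContDiffOn ℝ ⊤
(uncurry u) (Iio 0 ×ˢ univ) ∧ (∀ t < 0, IsDivFree (u t)) ∧ (∀ s t, s < t → t < 0 → ∀ x, u t x =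
heatFlow (u s) (t − s) x − ∫ τ in Ioo s t, ∫ y, oseenKernel (t − τ) (x − y) (u τ y) (u τ y)) ∧
HasTypeITimeDecay C u → ∀ t < 0, ∀ x, u t x = 0

## Mechanism in one paragraph ("continuous symmetries are free" = "a symmetry is a free
certificate")
Every PROVED case of (L') is a symmetric case, and in each the symmetry hands over a SCALAR WITH A
MAXIMUM PRINCIPLE — planar: ω (KNSS2009 Thm 5.1 = Seregin2014Notes Thm 4.13 p.114); axisymmetric, no
swirl: ω_φ/ϱ (Thm 5.2 = Thm 4.15 p.117); with swirl: Γ = ϱu_φ (Thm 5.3 = Thm 4.16 p.118,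
SereginSverak2009); self-similar: the NRS–Tsai head pressure Π (NRS1996 (2.9), Tsai1998).
Pineau–Vicol 2026 (arXiv:2607.09619 p.4) name the absence of such a scalar "the central obstruction,
and the reason that no Liouville theorem has so far been available for rotated self-similar
solutions". The route makes this the organising principle: (i) reduce X to the statement that every
element of A_C HAS a continuous symmetry (ForcedSymmetry) plus Liouville theorems on the symmetric
leaves, and (ii) attack the symmetry-free residual by MANUFACTURING the missing max-principle scalar
directly — the pressure-blind certificate Θ = (−t)|ω| (lever C), the Noether charges μ_ξ of the
similarity generators (lever A) — on a class made small by the far-past energy ledger (lever B).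

## How X is reached (rev 6): one open node, everything else closable
closes : ForcedSymmetry → RigidComotionVanishesOnEnd → HelicalEndLiouville → AxisymEndLiouville →
BackwardEndVanishing → LiouvilleKillsTypeI → NoTypeII → NoBlowupToClay → NavierStokesRegularity
(lean rc 0, 0 sorry; X is DERIVED inside the proof). (i) TIME-ANCHOR COLLAPSE (kernel-checked in
`closes`): A_C is shift-invariant but scalings are anchored, so ForcedSymmetry applied to u AND to
u(·−1) leaves on a backward end either a KILLING symmetry x ↦ a + Ax or a rigid co-motion, which the
Type-I rate alone kills (RigidComotionVanishesOnEnd, elementary) — no scaling / rotated-self-similar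
/ DSS leaf is on the critical path. (ii) KILLING LEAVES: a ∉ range A ⇒ u periodic in one direction ⇒
HelicalEndLiouville (NEW theorem, closable from tree facts: recentred zoom-out shrinks the period,
`KNSS2009_typeI_rate_liouville_holds`, Kato gap); a ∈ range A ⇒ AxisymEndLiouville, known in
Albritton–Barker's class 𝒦 = {𝐈 < ∞} (SereginSverak2009 Thm 3.1 = `AxisymmetricTypeIExclusion_holds`
+ persistence + blow-down) once FarPastLedger (NEW a-priori estimate ∫_{B_R}|u(t)|² ≤ K(C)R,
answering AlbrittonBarker2019 Rem 3.2 for ancient solutions) puts A_C ⊂ 𝒦. (iii) The ONE open node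
is ForcedSymmetry ≡ X modulo (i)–(ii) (Cruxes/ForcedSymmetry/Disproof.lean §4; 3/3 triagers) —
declared as such, with `why this form is easier` = the three levers of Rationale #2, each with its
object, named tool, precedent and a typed first theorem; at rev 6 the lever-C ENGINE is filed as a
route item — StretchingCertificateComparison (stmt-14340, support, a new theorem provable now: a
stretching certificate kills the element) — and the bet C⁺ = UniversalStretchingCertificate (every
element admits a certificate; typed, X ⇒ C⁺) is recorded with the kernel-checked glue C⁺ →
StretchingCertificateComparison → ForcedSymmetry (planner Sketch2.lean, attached on stmt-4052; the
formal split of the node waits for its final cycle per the 2026-08-15 ruling).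

Rationale: WHY THIS LINE. The Type-I half of Clay (A) is the Liouville statement (L') "no nontrivial Type-I
ancient mild solution" (KNSS2009 §6 Prop 6.1 + Lemma 6.1; AlbrittonBarker2019 Thm 1.1;
Seregin2014Notes Prop 3.10–3.11 pp.111–114, Conjecture p.113); X := TypeIAncientLiouville is (L') in
the KNSS Oseen gauge (the Type-II half NoTypeII = stmt-0056 is borrowed and declared, not attacked).
Every proved case of (L') is a case with a continuous symmetry, and in every one the symmetry
supplies a scalar with a maximum principle (Thesis §Mechanism; Seregin2014Notes Thms 4.13/4.15/4.16
pp.114–120 read; KNSS2009 Thms 5.1–5.3 read); Pineau–Vicol 2026 p.4 identify the missing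
max-principle scalar as THE obstruction for the first non-Killing symmetric leaf (rotated
self-similar, α ≈ 1). The crux chain of 2026-08-15/16 (3 ideators + 3 triagers on each of
ForcedSymmetry, LinearLiouvilleSeven, SymmetricLiouville, FiniteTangentModuli; standing disprovers)
turned the slogan into theorems ABOUT THE ROUTE: (1) the time-anchor collapse (ForcedSymmetry → X
needs only Killing leaves; inlined in `closes`); (2) the helical/periodic Type-I ancient leaf, open
in print (steady helical only: HanWangXie2025; periodic axisymmetric needs bounded Γ:
LeiRenZhang2019 Thm 1.1, LeiRenZhang2021), closes from tree theorems; (3) the far-past LEDGER A_C ⊂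
𝒦 (new vs AlbrittonBarker2019 Rem 3.2 p.7, read verbatim) is the enabling a-priori estimate of every
blow-down argument; (4) NEW at rev 6 — the first SYMMETRY-FREE certificate theorem on A_C
(StretchingCertificateComparison, stmt-14340, with its Gaussian corollary): Θ = (−t)|ω| obeys, off
{ω = 0}, the exact pressure-blind identity (∂_t + u·∇ − Δ)Θ = (Θ/(−t))(w − 1), w := (−t)(ξ·Sξ −
|∇ξ|²) (Kato + the stretching factor of MajdaBertozzi2002 §5.1 (5.8)–(5.9) p.152,
ConstantinFefferman1993), i.e. in similarity variables Θ is a bounded ETERNAL subsolution of ∂_s − Δ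
+ (y/2+U)·∇ − (w−1); a positive supersolution h with rate δ > 0 ("stretching certificate") forces Θ
≤ e^{−δ(s−s₀)}(sup Θ/h)h → 0 as s₀ → −∞, and the Ornstein–Uhlenbeck confinement y/2 makes h =
e^{α|y|²} a certificate that tolerates ANY bounded stretching outside one similarity ball. Imported
areas with their dictionaries: transformation groups (stabilisers in ⟨∂_t⟩ ⊕ sim(3), conjugacy of
one-parameter subgroups, screw ⊃ lattice); Noether charges of the similarity generators; the
principal-eigenvalue / positive-supersolution theory of non-self-adjoint drift–diffusion operators
(BerestyckiNirenbergVaradhan1994, DonskerVaradhan1975, Krein–Rutman; Feynman–Kac via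
ConstantinIyer2007 arXiv:math/0511067) transplanted to the similarity-gauge vorticity modulus.
GAUGE: KNSS Oseen-mild class (parasitic b(t) and Galilean frames removed, so u = 0 and exact
symmetries are meaningful); the disprovers' `_false_without_` theorems (Type-I decay, mildness back
to −∞, ancientness all load-bearing; p73328, p73829; LL7: pressure bound p75161) are honoured —
every item quantifies over IsTypeIAncientMild on backward ENDS, never on final windows; mild ⇒
classical NS pair and the similarity vorticity equation are PROVED tree theorems
(`IsTypeIAncientMild.exists_isClassicalNSSolutionOn_Ioo`, `IsTypeIAncientMild.lerayVorticity_eq`).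
RANKED CRUXES. #2 ForcedSymmetry (stmt-4052; every u ∈ A_C has a nonzero infinitesimal similarity
symmetry) — the route's ONE open node; by the collapse it is X modulo closable items (Disproof §4
`forcedSymmetry_of_typeIAncientLiouville` is the converse) — NOT weaker than X, declared. WHY THIS
FORM IS EASIER — three levers, each = object + named tool + precedent + typed first theorem + the
honest bet: (C) STRETCHING CERTIFICATES (cards vortex-stretching-wall, triage r1-1 §B / r1-3 pass,
identities machine-checked j009937:E,F; checked skeleton
Cruxes/LinearLiouvilleSeven/Lines/vortex-stretching-wall.lean, 6 stubs, 5 provable now). Object: Θ =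
(−t)|ω|, potential w. Tool: comparison with positive supersolutions = generalized principal
eigenvalue of H_U = Δ − (y/2+U)·∇ + w (BNV 1994; Donsker–Varadhan γ = sup_ν[∫w dν − I_U(ν)];
Agmon–Allegretto–Piepenbrink). Precedent: the four proved leaves ARE certificates (h = 1; ω_φ/ϱ; Γ;
Π), and vorticity-direction geometry already meets (L') in GigaMiura2011 / GigaHsuMaekawa2014 /
BarkerPrange2020 Thm 1 (continuous alignment in a parabolic cone + Type I ⇒ regular, by blow-up +
planar Liouville). Theorems that land regardless: StretchingCertificateComparison (rev-6 support
item stmt-14340: an element admitting a certificate (δ, A, h) vanishes; M–L, no compactness, no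
strong maximum principle), its Gaussian corollary (∀ε ∃R(ε,C): w ≤ 1−ε on {|x| ≤ R√(−t), ω ≠ 0} ⇒ u
≡ 0; typed in the planner's Sketch.lean), the closed wall ((−t)ξ·Sξ ≤ 1 on {ω≠0} ⇒ u ≡ 0;
compactness + strong max principle, Seregin2014Notes Thm 4.14 p.115 / Lieberman1996), and their
contrapositive STRUCTURE THEOREM: a nonzero element of A_C carries, inside EVERY backward paraboloid
{t < t₀, |x−x₀| ≤ R√(t₀−t)} (all x₀, t₀ ≤ 0 by the symmetries of A_C), points of ε-critical aligned
stretching w ≥ 1−ε along nearly straight vortex lines. The bet = UniversalStretchingCertificate (C⁺,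
typed in the planner's Sketch2.lean with the kernel-checked glue `forcedSymmetry_of_certificates :
C⁺ → StretchingCertificateComparison → ForcedSymmetry` and `universalStretchingCertificate_of_target
: X → C⁺`, attached on stmt-4052; not filed as an eighth crux — it is #2 in certificate form, and
the formal split waits for the node's final cycle): γ(u) < 1 for every u ∈ A_C — an OCCUPATION
inequality (Gaussian-typical, entropy-penalised aligned stretching below the self-similar rate 1),
monotone in w, certified by ANY positive test function, numerically estimable; kit j007088 (triage):
Gaussian/principal-eigenfunction certificates beat the pointwise wall by ×3–×10 for ring-localised
stretching and by nothing for bulk stretching, so for large C the NS coupling ω = curl u must enter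
through the Gaussian-window enstrophy budget ∫∫|∇U|²G ds ≲ C² + C³ (tree identities in
AncientSimilarityVorticity) and the −|∇ξ|² credit. (A) NOETHER CHARGES (card
noether-charge-subsolutions, triage ×3 pass, j008243/j009937:B,C,H): each generator ξ has a charge
μ_ξ — a·u; (a×x)·u; π = (−t)(p+½|u|²)+½x·u = Tsai's head pressure; |u|²/2 + p — with an EXACT
drift–heat equation sourced by the Jacobi pressure L_ξ p (−a·∇p; −(a×x)·∇p − 2a·ω; −(−t)|ω|² − ½q_σ,
q_σ = 2p + x·∇p + 2t∂_t p = −2(−t)^{-1}∂_s P_L a total log-time derivative; ∂_t p − |ω|²), so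
"ξ-symmetric" ⇔ "L_ξ p ≡ 0" ⇔ "μ_ξ has a maximum principle"; typed DilationChargeIdentity (S),
SlabSelfSimilarRigidity (M: scaling Jacobi field vanishing on ONE log-unit slab ⇒ u ≡ 0, by
`tsai_selfsimilar_bounded_holds` + ESS backward uniqueness `ess_backward_uniqueness_holds`); bet
CALM-SLAB (one-signed Fokker–Planck mean of ∂_sP_L on a long window; exact bookkeeping ∫∫(|Ω|² −
∂_sP)dm ds = [∫Π dm]). (B) LEDGER + CENSUS (cards far-past-energy-ledger, blow-down-census): with #3
every σ = 0 symmetry is lethal in 𝒦 (blow-down at a nonzero point +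
`PersistenceOfSingularities_holds` + `AxisymmetricTypeIExclusion_holds`), the residual inherits the
local Type-I toolbox (ε-regularity at the lid, AB Thm 1.1 zoom-out, Barker–Prange concentration),
and UniqueBlowDown (convergence of k u(k²t, x₀+kx), k → ∞ ⇒ self-similar ⇒ 0 by Tsai) is the one
reformulation that is a CONVERGENCE statement (the form closed elsewhere by Łojasiewicz–Simon,
ColdingMinicozzi2021). Residual risk, plainly: no monotone quantity for 3-D NS in similarity
variables is known (EnergySupercriticality); C⁺, CALM-SLAB and UniqueBlowDown are X-strength; the
gain is that the defect is now ONE named scalar (w, resp. L_ξ p) on a compact shift-invariant class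
where certificate duality and selection arguments apply, and five theorems land either way. #3
FarPastLedger (stmt-14060; ∀C ∃K ∀u ∈ A_C ∀t,x₀,R: ∫_{B_R(x₀)}|u(t)|² ≤ K R, the Leray rate; content
R ≫ √(−t)): provable M–L by the entry-time local energy ledger (enter at −R² where E ≤ C²R; fluxes
C³R²(−τ)^{-3/2} with BMO Oseen pressure; bootstrap 3 → 2 → 1+log → 1 — the last step is log-free for
the local fluxes because ∫₀ σ^{-1/2}log(1/σ)dσ < ∞, re-derived this pass; the risk sits in the
harmonic far part of the pressure); corollaries: A_C ⊂ 𝒦 (refuter g48 checked), super-parabolic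
SPARSENESS (−t)R^{-3}sup_a∫_{B_R(a)}|u|² → 0 as R/√(−t) → ∞ uniformly on A_C, and δ₀ is the only
translation-invariant law on A_C (Kármán–Howarth e′ = −2E|∇w|² ≤ 0, e(−∞) = 0; card
superparabolic-energy-sparseness). #4 AxisymEndLiouville (stmt-14061; rotations about ANY axis,
swirl allowed, on an end ⇒ 0): known in 𝒦 after #3 (SS2009 Thm 3.1 + persistence + blow-down);
without #3 only an unprinted KNSS-6.2 point selection. #5 in priority (filed rank 7)
HelicalEndLiouville (stmt-14062; Killing generator with a ∉ range A): NEW, M (screw ⊃ lattice ⇒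
periodic ⇒ zoom-out ⇒ `KNSS2009_typeI_rate_liouville_holds` ⇒ Kato gap); nearest print
LeiRenZhang2021 (axisymmetric, ℝ²×𝕋). #6 NoTypeII (stmt-0056, borrowed, = the Type-II half of Clay
A). #7 SymmetricLiouville (stmt-4053; conjecture-grade record of the rev-1 dichotomy X ⇔
ForcedSymmetry ∧ SymmetricLiouville, auto-kept crux by the gate; OFF `closes`: its Killing rows are
#4/#5, its rotated-self-similar bounded-profile row = PineauVicol2026 Conj 1.1 / Thm 1.4 (|α| ≪ 1 or
≫ 1 only) stays as kill criterion 2) and FiniteTangentModuliMild (stmt-14049, filed rank 5 by the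
FiniteTangentModuli repair chain: the repaired linear count in the x-bounded linearised-mild gauge
for general Type-I drifts; off `closes`, not an engine for #2 — its bounded envelope cannot host the
linearly growing rotation/scaling Jacobi fields — kept with its standing disprover). SUPPORT:
StretchingCertificateComparison (NEW rev 6, stmt-14340, lever C engine, M–L, provable now from the
checked skeleton Cruxes/LinearLiouvilleSeven/Lines/vortex-stretching-wall.lean stubs 1–3);
RigidComotionVanishesOnEnd and BackwardEndVanishing (hypotheses of `closes`, paper proofs checked
TRUE by refuter g48); LiouvilleKillsTypeI (known zoom glue); NotFiniteTangentModuli (settled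
negative edge p73226); NoBlowupToClay PROVED; LinearLiouvilleSeven (stmt-4054, the rev-1 linear
engine and the tier-deciding crux of the 2026-08-15 judging): HELD support — negative lemma
GalileanNontrivial → ¬LL7 landed (p74875, with p74588/p74858/p74864/p75161 under
Theorems/LinearLiouvilleSeven/Negative/), H ⟺ ¬X, and kernel-checked LL7 ⇔ X ∧ (tempered-Stokes
anchor, landed p72133/p72234/p72245/p74208): the count in the slice-constant quotient is the target
in costume; route-choice ruling 2026-08-16: keep as held support, do NOT restate (every linear count
— LL4M, the mild-gauge LLmild8 made honest by #3 — has the truth value of X), do not drop (four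
landed Negative modules import it). Assembly (stmt-4051) kept as the record of the rev-1 dichotomy
path (the gate keeps assembly items); `closes` is the deciding theorem.
KILL CRITERIA. (1) Any nontrivial Type-I KNSS-mild ancient element (backward DSS/RDSS profile:
BradshawTsai2017CPDE Open Problem 5.1, Tsai2018 Conj 8.8–8.9) refutes X and closes the route — no
pivot, the line IS (L'). (2) Any nonzero element with DISCRETE Euclidean stabiliser refutes #2 even
if self-similar: a time-shifted rotated-self-similar solution with bounded profile at α ≈ 1
(PineauVicol2026 Thm 1.4 covers |α| ≪ 1, ≫ 1 and decaying profiles (1.10)), or a λ-DSS profile with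
finite point group. (3) A nonzero element with ∫_{B_R}|u(t)|² ≫ R on a family of balls refutes #3
and demotes lever B (route survives on #2 with A, C; #4 then needs the point-selection proof). (4) A
z-periodic or helical nonzero Type-I ancient mild solution refutes #5-priority HelicalEndLiouville
and X. (5) FIRED 2026-08-16: the linear falsifier (tempered modes around a non-NS Type-I shear,
p73226) refuted FiniteTangentModuli and, with the Galilean collapse (p74875), retired the linear
engine. (6) A Type-II blow-up refutes NoTypeII = ¬(Clay A). (7) Lever C: a bounded ETERNAL
Leray-variable profile (it need not solve NS — any Type-I-compatible drift/stretching pair,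
numerically) whose Gaussian-window occupation of aligned stretching stays ≥ 1 kills the USEFULNESS
of C⁺'s certificates (the two certificate theorems survive); a nonzero u admitting a certificate
would refute StretchingCertificateComparison outright (excluded if the checked comparison argument
is right).
NOT DECOMPOSED YET (deliberately; ≤ two layers). The `--split` of #2 along lever C — children
UniversalStretchingCertificate (crux) → StretchingCertificateComparison (support), glue already
kernel-checked — is PREPARED (children.json + Sketch2.lean attached on stmt-4052) for the node's
final cycle. Below stmt-14340 ride the line's stubs as `--supports` lemmas, never items (Kato
similarity identity M, certificate comparison M–L, similarity gradient bound S–M, Gaussian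
certificate M; then the closed wall), and C⁺ is attacked via (i) the dual occupation statement
d/ds∫Θm ≤ ∫(w − 1 − U·y/2)Θm, (ii) the Gaussian-window enstrophy budget, (iii) alignment ⟪DUξ,ξ⟫ ≤
λ_max(S) with the −|Dξ|² credit; the node stays claimable for a direct proof (lead line
time-anchor-bootstrap). Undecomposed: lever A: DilationChargeIdentity (S), SlabSelfSimilarRigidity
(M), AntiBernoulliOfDilationSubsolution (M), CALM-SLAB; lever B: NonScalingSymmetryIsLethal in 𝒦
(L), UniqueBlowDown, LiouvilleInLaw. Children of #3: FarPastLedgerStepOne (entry-time bound, S–M),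
CZ/BMO gauge-pressure facts to vendor, UniformSparseness. Children of HelicalEndLiouville:
HelicalOrTranslationIsPeriodic (S) → PeriodicEndLiouville (M) with KNSS compactness/mild closure
(shared with LiouvilleKillsTypeI) and rotation covariance of the Oseen class. Children of #4:
blow-down in 𝒦 + persistence + SS2009. VertexLemma (ForcedSymmetry ↔ ForcedIsometry, S–M,
Cruxes/ForcedSymmetry/SketchIdeator3.lean; InteriorVertexVanishing landed as
Theorems/SymmetryModuliCountForcedSymmetryInteriorVertexVanishing.lean) rides as `--supports
ForcedSymmetry`. A separate thin route "StretchingCertificates" (X ⇐ C⁺ + comparison; cruxes C⁺, the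
Gaussian-window stretching budget, the closed wall) is the natural home if lever C outgrows this
route — recorded, not opened here.
CHEAPEST FALSIFIER. For the open node in its most computable corner (kill 2): a nontrivial BOUNDED
profile of the rotated Leray equations at α ≈ 1 (PineauVicol2026 Conj 1.1) by one kit continuation
job in α on a Hermite–Galerkin truncation from the α = 0 branch (which carries no nonconstant
bounded profile: `tsai_selfsimilar_bounded_holds`); a converged branch re-certified by interval
Newton refutes #2 and X; an empty certified window is weak evidence. For lever C (kill 7, cheaper
still): Hermite–Galerkin principal eigenvalue γ of H_U = Δ − (y/2+U)·∇ + w for trial profiles — done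
for the ring drift (j007088: A_wall ≈ 0.8 vs A_cert ≈ 2.5–3; annulus at 5 ≤ r ≤ 6: gain ≈ ×10);
next: a DSS-like trial profile taken from BradshawTsai numerics with a Type-I-compatible enstrophy
budget — if γ ≥ 1 is typical there, C⁺ adds nothing beyond the two certificate theorems. Consistency
checks already run: FarPastLedger fails, as it must, for the non-mild parasitic field c e/√(−t) and
is saturated by |x|^{-1} tails; the end-statements are immune to the disprovers' window witnesses
(viscous shear wave, faded constants) because they keep the far past; the certificate arithmetic was
re-derived by three triagers (sign of y/2 confining for the ANCIENT problem; C₁ < 1 makes the wall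
automatic and Θ decays outright — consistent, not vacuous).

Novelty: NOVELTY (rev 6, 2026-08-16). Searches on record from revs 2/5 (kept, see git history of this
header): `lit search --hybrid` (Liouville/ancient/helical/self-similar; 12 held docs, symmetric
cases only), zbMATH helical (HanWangXie2025: steady only) / rotated-self-similar-backward (0), S2
linearised-count (0), `lit vsearch` ×4 (periodic/helical Type-I ancient Liouville: none in
Seregin2014Notes pp.109–129, LemarieRieusset2016 pp.322–325, RobinsonRodrigoSadowski2016), `lit
galaxy search --star all` ×4 (0), `lit read` arXiv:2607.09619, 1902.01736, 1902.11229
(LeiRenZhang2019 Thm 1.1), 1811.00502 p.7, `lit frontier`/`lit bridges`. Added at rev 6 (lever C +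
source audit): zbMATH "Liouville ancient solutions Navier-Stokes" (16 rows: KNSS2009,
SereginShilkin2018 survey arXiv:1703.10822, JiaSereginSverak2012 arXiv:1201.1664, LeiZhang2011,
LeiRenZhang2021 arXiv:1911.01571 (axisymmetric ℝ²×𝕋 — nearest print to HelicalEndLiouville),
AlbrittonBarker2019/2020 arXiv:1811.00502/1811.00507), zbMATH "Type I blow-up Navier-Stokes
vorticity direction" (GigaMiura2011 doi:10.1007/s00220-011-1197-x, GigaGuHsu2019
doi:10.1016/j.na.2019.111579, BarkerPrange2020 arXiv:1906.08225), zbMATH "Liouville theorem bounded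
ancient mild solutions Type I" (AlbrittonBarker2019 only), zbMATH "ancient solutions self-similar
variables Liouville" (0), "geometric regularity criterion Liouville planar" (GigaHsuMaekawa2014
arXiv:1310.6471), zbMATH for the certificate tools (BerestyckiNirenbergVaradhan1994, DonskerVaradha  [refs: 10.1007/s00220-011-1197-x, 10.1016/j.na.2019.111579, 2607.09619, 1703.10822, 1201.1664, 1911.01571, 1811.00502, 1906.08225, 1310.6471, 0709.3599, 0804.1803, 1711.00823, 1902.01736, doi:10.1007/s00220-011-1197-x, doi:10.1016/j.na.2019.111579, HanWangXie2025, LemarieRieusset2016, RobinsonRodrigoSadowski2016, LeiRenZhang2019, KNSS2009, SereginShilkin2018, JiaSereginSverak2012, LeiZhang2011, LeiRenZha]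

Barriers (technique_class: similarity-stabiliser-liouville supersolution-certificate): - technique_class: similarity-stabiliser-liouville noether-charge-max-principle
supersolution-certificate
BARRIERS (catalogue Literature/Barriers/NavierStokesRegularity read in full; the far-past ledger is
scale-critical bookkeeping, not a class of its own).
- Literature.Barriers.NavierStokesRegularity.TaoAveragedBlowup: evaded by hypothesis, twice. (1)
Every item uses EXACT structure that Tao's averaged bilinear operator B̃ (arXiv:1402.0290 §1)
destroys: exact Sim(3)- and time-shift-covariance of the Oseen-mild class (the time-anchor collapse
in `closes` is pure symmetry algebra + the Type-I rate), exact Killing fields (HelicalEndLiouville,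
AxisymEndLiouville), and for the residual the POINTWISE vorticity form of the true nonlinearity —
ω·∇u stretching, u·∇ transport with div u = 0, Kato's chain rule for |ω|, the sign of −|∇ξ|² (lever
C; listed in the entry's own evasions "controls the nonlinearity pointwise by u, ∇u in vorticity
form"), the exact Lamb decomposition, the pressure–Poisson law and q_ξ = L_ξ p (lever A) — an
averaged equation has no swirl, no head pressure, no Jacobi pressures, no vorticity modulus with a
one-signed stretching defect. (2) Tao's witness is Type II (critical norms diverge, §1.1 fn. p.8),
outside X = (L'); NoTypeII (stmt-0056) is borrowed and openly NOT evaded.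
- Literature.Barriers.NavierStokesRegularity.TruncatedDyadicBlowup and facet
TruncatedDyadicTypeIBlowup: a forward, exogenously switched dyadic ODE at the Type-I rate; it
constructs no ANCI

History (route lifecycle, newest last):
- 2026-08-15T16:15:37Z · rev 2: dropped LiouvilleConjectureImplies — route-repair (glue + cone, rbadge g4): (1) deciding theorem supplied - closes (hF : ForcedSymmetry) (hS : SymmetricLiouville) (hK : LiouvilleKillsTypeI) (hII : (planner-rbadge-NavierStokesRegularity-Symmetry-41083082-g4-0)
- 2026-08-16T01:23:37Z · BROKEN — FiniteTangentModuli (stmt-NavierStokesRegularity-4055, crux) refuted by Summit.NavierStokesRegularity.NavierStokesRegularity.Theorems.SymmetryModuliCountFiniteTangentModuli_refuted (refuter-cdisprove-stmt-NavierStokesRegularity-4055-g2-0)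
- 2026-08-16T01:32:49Z · rev 3: dropped FiniteTangentModuli — repair rev 3 (route-repair seat, class MISSTATED/gauge): FiniteTangentModuli (stmt-4055, crux r5, wanted only by this route) refuted by Theorems.SymmetryModuliC (planner-rfix-NavierStokesRegularity-Symmetry-41083082-0)
- 2026-08-16T01:32:49Z · REPAIRED (drop FiniteTangentModuli) — back to open: repair rev 3 (route-repair seat, class MISSTATED/gauge): FiniteTangentModuli (stmt-4055, crux r5, wanted only by this route) refuted by Theorems.SymmetryModuliC (planner-rfix-NavierStokesRegularity-Symmetry-41083082-0)
- 2026-08-16T02:17:25Z · rev 7: dropped JacobiFieldsTempered — rev 5 item budget: drop support JacobiFieldsTempered (stmt-4057) — it only fed the LinearLiouvilleSeven => ForcedSymmetry bridge, moot now that LL7 = X ∧ AtZero (planner-promote-NavierStokesRegularity-Symmetr-41083082-0)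
- 2026-08-16T06:34:05Z · rev 14: dropped FiniteTangentModuliMild, NotFiniteTangentModuli, NoBlowupToClay — route-repair (unused-crux, rrepair-6deee1c1): 2 glued / 1 dropped (+2 slot-freeing drops: items-cap 15, route was at 16). GLUED: FarPastLedger via stmt-14736 Ax (planner-rrepair-NavierStokesRegularity-Symmetr-6deee1c1-0)
- 2026-09-04T10:54:32Z · DORMANT — reconciler: no traction for 5 d (last activity statement-claimed at 2026-08-30T10:20:50Z); parked, not closed — `ledger route dormant route-NavierStokesRegulari (operator:999:3985629)

sub-problem: NavierStokesRegularity · status: dormant · opened planner-plancard-NavierStokesRegularity-Navie-f68c2891-0 2026-08-15T11:27:19Z · rev 14 · ledger route-NavierStokesRegularity-SymmetryModuliCount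
GENERATED by the gate from the ledger (D-0016/17). Provers cite these decls: `theorem foo : Summit.NavierStokesRegularity.NavierStokesRegularity.Theses.SymmetryModuliCount.<Decl> := …` in Summits/NavierStokesRegularity/NavierStokesRegularity/Theorems/<Name>.lean.
-/

namespace Summit.NavierStokesRegularity.NavierStokesRegularity.Theses.SymmetryModuliCount

open scoped BigOperators Topology Manifold Classical MeasureTheory ProbabilityTheory Matrix InnerProductSpace ComplexConjugate ContinuousMap
open Filter Set Function TopologicalSpace MeasureTheory

attribute [summit_statement] _root_.NavierStokesRegularity

open Literature.NS

/-! Retired items kept as plain definitions (history; not obligations of this route): landed proofs / closed glue still name them. -/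

-- tombstone: stmt-NavierStokesRegularity-0055 was DROPPED from this route but is still named by active items / landed proofs — kept as a plain def (no route_item tag), not an obligation of this route
/-- retired stmt-NavierStokesRegularity-0055 (dropped, gen None) — proved by Summit.NavierStokesRegularity.NavierStokesRegularity.Theorems.typeICertificateLadder_noBlowupToClay_proof @ 8d57e70af7e2. -/
def NoBlowupToClay : Prop :=
  (∀ (ν T : ℝ), 0 < ν → 0 < T → ∀ (u : ℝ → EuclideanSpace ℝ (Fin 3) → EuclideanSpace ℝ (Fin 3)) (p : ℝ → EuclideanSpace ℝ (Fin 3) → ℝ), Literature.Analysis.FluidPDE.IsClassicalNSSolutionOn (Set.Ico 0 T) ν 0 u p → Literature.Analysis.FluidPDE.IsLerayHopfOn T ν 0 (u 0) u → Literature.Analysis.FluidPDE.HasRapidSpatialDecay (u 0) → Literature.Analysis.FluidPDE.HasSmoothExtensionPast ν 0 u T) → NavierStokesRegularity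

-- tombstone: stmt-NavierStokesRegularity-4055 was DROPPED from this route but is still named by active items / landed proofs — kept as a plain def (no route_item tag), not an obligation of this route
/-- retired stmt-NavierStokesRegularity-4055 (dropped, gen None) — refuted by Summit.NavierStokesRegularity.NavierStokesRegularity.Theorems.SymmetryModuliCountFiniteTangentModuli_refuted. -/
def FiniteTangentModuli : Prop :=
  ∀ (C : ℝ) (u : ℝ → EuclideanSpace ℝ (Fin 3) → EuclideanSpace ℝ (Fin 3)), ContDiffOn ℝ (⊤ : ℕ∞) (Function.uncurry u) (Set.Iio 0 ×ˢ Set.univ) → (∀ t < 0, Literature.Analysis.FluidPDE.VectorCalculus.IsDivFree (u t)) → Literature.Analysis.FluidPDE.HasTypeITimeDecay C u → (∀ t < 0, ∀ x, ‖fderiv ℝ (u t) x‖ ≤ C / (-t)) → ∃ N : ℕ, ∀ (v : Fin (N + 1) → ℝ → EuclideanSpace ℝ (Fin 3) → EuclideanSpace ℝ (Fin 3)) (q : Fin (N + 1) → ℝ → EuclideanSpace ℝ (Fin 3) → ℝ), (∀ i, (ContDiffOn ℝ (⊤ : ℕ∞) (Function.uncurry (v i)) (Set.Iio 0 ×ˢ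 Set.univ) ∧ ContDiffOn ℝ (⊤ : ℕ∞) (Function.uncurry (q i)) (Set.Iio 0 ×ˢ Set.univ) ∧ (∃ K : ℝ, ∀ t < 0, ∀ x, ‖(v i) t x‖ ≤ K / Real.sqrt (-t) + K * (1 + ‖x‖) / (-t) ∧ |(q i) t x| ≤ K / (-t) + K * (1 + ‖x‖) / Real.sqrt (-t) ^ 3) ∧ (∀ t < 0, Literature.Analysis.FluidPDE.VectorCalculus.IsDivFree ((v i) t)) ∧ (∀ t < 0, ∀ x, Literature.Analysis.FluidPDE.timeDeriv (v i) t x + Literature.Analysis.FluidPDE.convect (u t) ((v i) t) x + Literature.Analysis.FluidPDE.convect ((v i) t) (u t) x = Laplacian.laplacian ((v i) t) x - gradient ((q i) t) x))) → ∃ c : Fin (N + 1) → ℝ, c ≠ 0 ∧ ∀ t < 0, ∃ b : EuclideanSpace ℝ (Fin 3), ∀ x, ∑ i, c i • v i t x = b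

/-- item stmt-NavierStokesRegularity-4050 · target · rank 0 · open · by planner
why it might fail: ¬X = a nontrivial Type-I ancient mild solution: a backward DSS/RDSS blow-up profile (BradshawTsai2017CPDE OP 5.1; Tsai2018 Conj 8.8–8.9) or an RSS with bounded profile at α≈1 (PineauVicol2026 Conj 1.1); open even with one discrete symmetry (ChaeWolf2017RemovingDSS: λ≈1 or small C only).
sources: KNSS2009, AlbrittonBarker2019, Seregin2014Notes, BradshawTsai2017CPDE, ChaeWolf2017RemovingDSS, PineauVicol2026
[target] X = (L') in the KNSS gauge: every element of A_C := {u smooth on (-inf,0)xR^3, div-free,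
KNSS-mild (Oseen integral equation u(t)(x) = heatFlow(u(s))(t-s)(x) - ∫_{τ∈(s,t)} ∫_y oseenKernel
(t-τ) (x-y) (u τ y) (u τ y) for all s<t<0, i.e. u(t) = e^{(t-s)Δ}u(s) - oseenDuhamel 1 s u u t of
NSBoundedMildOseen.lean written out with the in-tree oseenKernel: the gauge without parasitic b(t) /
time-dependent Galilean frames; KNSS2009 §1 (1.7)-(1.9), Seregin2014Notes Def 6.3 p.109, p.113),
HasTypeITimeDecay C u (|u| <= C/sqrt(-t))} is identically zero on t<0. Equivalent to ForcedSymmetry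
∧ SymmetricLiouville (Sketch.lean: X ⇒ each; both ⇒ X trivially). Implied by (L) =
stmt-NavierStokesRegularity-0057 (support LiouvilleConjectureImplies). Kills Type-I blow-up via
LiouvilleKillsTypeI. [sources: KNSS2009 §1, §6 Prop 6.1; AlbrittonBarker2019 Thm 1.1;
Seregin2014Notes pp.109-114; SereginSverak2009 §4] -/
@[route_item "route-NavierStokesRegularity-SymmetryModuliCount"]
def TypeIAncientLiouville : Prop :=
  ∀ (C : ℝ) (u : ℝ → EuclideanSpace ℝ (Fin 3) → EuclideanSpace ℝ (Fin 3)), ContDiffOn ℝ (⊤ : ℕ∞) (Function.uncurry u) (Set.Iio 0 ×ˢ Set.univ) ∧ (∀ t < 0, Literature.Analysis.FluidPDE.VectorCalculus.IsDivFree (u t)) ∧ (∀ s t : ℝ, s < t → t < 0 → ∀ x, u t x = Literature.Analysis.FluidPDE.heatFlow (u s) (t - s) x - ∫ τ in Set.Ioo s t, ∫ y, Literature.Analysis.FluidPDE.oseenKernel (t - τ) (x - y) (u τ y) (u τ y)) ∧ Literature.Analysis.FluidPDE.HasTypeITimeDecay C u → ∀ t < 0, ∀ x, u t x = 0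

/-- item stmt-NavierStokesRegularity-4052 · crux · rank 2 · open · by planner
why it might fail: ≡ X mod closable Killing leaves (collapse; Disproof §4): any nonzero Type-I mild ancient element with DISCRETE Euclidean stabiliser refutes it — a time-shifted RSS with BOUNDED profile at α≈1 (PineauVicol2026 Thm 1.4 covers |α|≪1, ≫1 only) or a DSS profile (BradshawTsai2017CPDE OP 5.1).
sources: BradshawTsai2017CPDE, PineauVicol2026, arXiv:2607.09619, KNSS2009, AlbrittonBarker2019, Tsai1998
[crux] 'Seven moduli do not fit': every u in A_C := {u smooth on (-inf,0)xR^3, div-free, KNSS-mild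
(Oseen integral equation u(t)(x) = heatFlow(u(s))(t-s)(x) - ∫_{τ∈(s,t)} ∫_y oseenKernel (t-τ) (x-y)
(u τ y) (u τ y) for all s<t<0, i.e. u(t) = e^{(t-s)Δ}u(s) - oseenDuhamel 1 s u u t of
NSBoundedMildOseen.lean written out with the in-tree oseenKernel: the gauge without parasitic b(t) /
time-dependent Galilean frames; KNSS2009 §1 (1.7)-(1.9), Seregin2014Notes Def 6.3 p.109, p.113),
HasTypeITimeDecay C u (|u| <= C/sqrt(-t))} admits a nonzero ξ = (a, σ, A) ∈ sim(3) = R^3 ⋊ (R ⊕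
so(3)) (A skew: ⟪Ax,x⟫ = 0) whose infinitesimal generator L_ξ u = ∇u·(a + σx + Ax) + σu + 2σt ∂_t u
− Au vanishes identically (u is invariant under a one-parameter group of
translations∘rotations∘scalings). The residual of the dichotomy X ⇔ ForcedSymmetry ∧
SymmetricLiouville; intended engines: (i) LinearLiouvilleSeven + JacobiFieldsTempered + the gauge
lemma 'L_ξ u slice-constant ⇒ L_ξ u = 0 in the KNSS gauge' (first tenure split), (ii) the card's
nonlinear count: orbit of a point with discrete stabiliser embeds a closed 7-ball in A_C (invariance
of domain) versus a CFT/Lieb–Thirring bound dim_F A_C ≤ d(C) in Ler -/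
@[route_item "route-NavierStokesRegularity-SymmetryModuliCount"]
def ForcedSymmetry : Prop :=
  ∀ (C : ℝ) (u : ℝ → EuclideanSpace ℝ (Fin 3) → EuclideanSpace ℝ (Fin 3)), ContDiffOn ℝ (⊤ : ℕ∞) (Function.uncurry u) (Set.Iio 0 ×ˢ Set.univ) ∧ (∀ t < 0, Literature.Analysis.FluidPDE.VectorCalculus.IsDivFree (u t)) ∧ (∀ s t : ℝ, s < t → t < 0 → ∀ x, u t x = Literature.Analysis.FluidPDE.heatFlow (u s) (t - s) x - ∫ τ in Set.Ioo s t, ∫ y, Literature.Analysis.FluidPDE.oseenKernel (t - τ) (x - y) (u τ y) (u τ y)) ∧ Literature.Analysis.FluidPDE.HasTypeITimeDecay C u → ∃ (a : EuclideanSpace ℝ (Fin 3)) (σ : ℝ) (A : EuclideanSpace ℝ (Fin 3) →L[ℝ] EuclideanSpace ℝ (Fin 3)), (∀ x, inner ℝ (A x) x = 0) ∧ ¬ (a = 0 ∧ σ = 0 ∧ A = 0) ∧ ∀ t < 0, ∀ x, fderiv ℝ (u t) x (a + σ • x + A x) + σ • u t x + (2 * σ * t) • Literature.Analysis.FluidPDE.timeDeriv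 u t x - A (u t x) = 0

/-- item stmt-NavierStokesRegularity-14060 · crux · rank 3 · closed · proved by Summit.NavierStokesRegularity.NavierStokesRegularity.Theorems.FarPastLedger_proof @ b26b350acaf3 (prover) · by planner
why it might fail: The harmonic far part of the nonlocal Oseen pressure flux could cost a log, E ≤ K·R·log(R²/(−t)) — AlbrittonBarker2019 Rem 3.2's caution (the local-flux bootstrap 3→2→1+log→1 is log-free: ∫₀σ^{-1/2}log(1/σ)dσ<∞); a nonzero element with ∫_{B_R}|u(t)|² ≫ R on some balls refutes it.
sources: AlbrittonBarker2019, arXiv:1811.00502, KNSS2009, arXiv:0709.3599, Seregin2014Notes, LemarieRieusset2016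
[crux] The far-past energy LEDGER at the Leray rate: for every C there is K = K(C) such that every u
in A_C (IsTypeIAncientMild C u = the route's inline class, `isTypeIAncientMild_iff`) satisfies
∫_{B_R(x₀)} |u(t,x)|² dx ≤ K·R for all t < 0, all centres x₀ and all R > 0 — scale-invariant under u
↦ λu(λ²t, λx), trivially true for R² ≲ (−t) from |u| ≤ C/√(−t); the content is R ≫ √(−t).
Equivalently A_C ⊂ 𝒦 := Albritton–Barker's local Type-I class {𝐈 < ∞} (velocity part A ≤ K; then
C(Q_r) ≤ 2CK from |u|³ ≤ ‖u‖∞|u|², and D, E follow from the local energy inequality +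
Calderón–Zygmund). This ANSWERS AlbrittonBarker2019 Remark 3.2 (arXiv:1811.00502 p.7: 'sup √(−t)‖v‖∞
< ∞ alone does not appear to guarantee 𝐈 < ∞') positively for ANCIENT solutions (AB's own proof
splits from t = −1 and never uses the far past). Proof plan (card far-past-energy-ledger; re-derived
term by term by triage r1-1 and r1-2 of crux ForcedSymmetry): run the exact local energy identity on
B_R(x₀) from the parabolic ENTRY time −4R², where E_R ≤ ½C²|B_R|/(−t) is already at the Leray rate;
with the KNSS gauge bounds |∇u| ≤ C₁/(−t) and the Oseen pressure p = R_iR_j(u_iu_j), ‖p(τ)‖_BMO ≤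
C₂/(−τ), |∇p| ≲ (−τ)^{-3/2}, mean -/
@[route_item "route-NavierStokesRegularity-SymmetryModuliCount"]
def FarPastLedger : Prop :=
  ∀ C : ℝ, ∃ K : ℝ, ∀ (u : ℝ → EuclideanSpace ℝ (Fin 3) → EuclideanSpace ℝ (Fin 3)), Literature.Analysis.FluidPDE.IsTypeIAncientMild C u → ∀ t < 0, ∀ (x₀ : EuclideanSpace ℝ (Fin 3)) (R : ℝ), 0 < R → ∫ x in Metric.ball x₀ R, ‖u t x‖ ^ 2 ≤ K * R

-- `FarPastLedger` holds: proved by `Summit.NavierStokesRegularity.NavierStokesRegularity.Theorems.FarPastLedger_proof` @ b26b350acaf3 (its module imports this route file, so no `_holds` link can be stated here).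

/-- item stmt-NavierStokesRegularity-4053 · crux (kind.auto-crux: conjecture-grade) · rank 3 · open · by planner
why it might fail: Conjecture-grade record of the rev-1 dichotomy, off `closes` (Killing rows = items 14061/14062): a rotated-self-similar solution with merely BOUNDED profile at α≈1 (PineauVicol2026 Thm 1.4 needs decay (1.10), |α|≪1 or ≫1) or a helical Type-I ancient solution refutes it and (L).
sources: KNSS2009, SereginSverak2009, Tsai1998, PineauVicol2026, HanWangXie2025, arXiv:2607.09619
[crux] 'Continuous symmetry is free' = the discrete-stabiliser theorem: if u in A_C := {u smooth on
(-inf,0)xR^3, div-free, KNSS-mild (Oseen integral equation u(t)(x) = heatFlow(u(s))(t-s)(x) -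
∫_{τ∈(s,t)} ∫_y oseenKernel (t-τ) (x-y) (u τ y) (u τ y) for all s<t<0, i.e. u(t) = e^{(t-s)Δ}u(s) -
oseenDuhamel 1 s u u t of NSBoundedMildOseen.lean written out with the in-tree oseenKernel: the
gauge without parasitic b(t) / time-dependent Galilean frames; KNSS2009 §1 (1.7)-(1.9),
Seregin2014Notes Def 6.3 p.109, p.113), HasTypeITimeDecay C u (|u| <= C/sqrt(-t))} is annihilated by
the generator L_ξ of a nonzero ξ = (a, σ, A) ∈ sim(3), then u ≡ 0. Up to conjugation in Sim(3)
(which preserves A_C and the gauge) the one-parameter subgroups are: (T) translations — u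
independent of x₃ ⇒ horizontal part is 2-D bounded ancient mild ⇒ constant (KNSS2009 Thm 5.1 = fact
KNSS2009_liouville_planar) ⇒ 0 by Type-I decay, then u₃ ancient bounded caloric ⇒ 0 [known]; (R_h)
screw motions of pitch h — h = 0 axisymmetric (swirl allowed) ⇒ |u| ≤ C'/r scale-uniformly
(SereginSverak2009 Prop 3.7 = in-tree AxisDecayBound, Thm 1.1/3.1 =
Barriers…AxisymmetricTypeIExclusion) ⇒ 0 (KNSS2009 Thm 5.3 = KNSS2009_liouvill -/
@[route_item "route-NavierStokesRegularity-SymmetryModuliCount"]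
def SymmetricLiouville : Prop :=
  ∀ (C : ℝ) (u : ℝ → EuclideanSpace ℝ (Fin 3) → EuclideanSpace ℝ (Fin 3)), ContDiffOn ℝ (⊤ : ℕ∞) (Function.uncurry u) (Set.Iio 0 ×ˢ Set.univ) ∧ (∀ t < 0, Literature.Analysis.FluidPDE.VectorCalculus.IsDivFree (u t)) ∧ (∀ s t : ℝ, s < t → t < 0 → ∀ x, u t x = Literature.Analysis.FluidPDE.heatFlow (u s) (t - s) x - ∫ τ in Set.Ioo s t, ∫ y, Literature.Analysis.FluidPDE.oseenKernel (t - τ) (x - y) (u τ y) (u τ y)) ∧ Literature.Analysis.FluidPDE.HasTypeITimeDecay C u → ∀ (a : EuclideanSpace ℝ (Fin 3)) (σ : ℝ) (A : EuclideanSpace ℝ (Fin 3) →L[ℝ] EuclideanSpace ℝ (Fin 3)), (∀ x, inner ℝ (A x) x = 0) → ¬ (a = 0 ∧ σ = 0 ∧ A = 0) → (∀ t < 0, ∀ x, fderiv ℝ (u t) x (a + σ • x + A x) + σ • u t x + (2 * σ * t) • Literature.Analysis.FluidPDE.timeDeriv u t x - A (u t x) = 0) → ∀ t < 0, ∀ x,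 u t x = 0

/-- item stmt-NavierStokesRegularity-14061 · crux · rank 4 · closed · proved by Summit.NavierStokesRegularity.NavierStokesRegularity.Theorems.AxisymEndLiouville_of @ 2c55acfedbed (prover) · by planner
why it might fail: Only the temporal bound is available for abstract ancient elements: the printed C/r route (KNSS Thm 5.3 = Seregin2014Notes Thm 4.16 p.118) needs far-field decay, the SS2009 local route needs scaled energies = FarPastLedger; if #3 loses its log the leaf rests on an unprinted point-selection argument.
sources: SereginSverak2009, arXiv:0804.1803, KNSS2009, arXiv:0709.3599, Seregin2014Notes, AlbrittonBarker2019
[crux] Axisymmetric leaf of the discrete-stabiliser theorem on a backward END, swirl allowed, ANY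
axis: if u ∈ A_C (IsTypeIAncientMild C u) is annihilated on t < θ (θ ≤ 0) by the rotations about the
axis through c generated by a nonzero skew A (∇u·A(x−c) − Au = 0) then u ≡ 0 on t < θ. This is the
refuter route-review's Objection 1 budgeted as an item, not a cite: KNOWN in print for the blow-up
problem (SereginSverak2009 Thm 3.1 = Thm 1.1 = tree `AxisymmetricTypeIExclusion_holds`: axisymmetric
suitable weak solutions in a cylinder with |v| ≤ C/√(−t) are regular at the vertex; KNSS2009 Thms
5.3, 6.2 need |u| ≤ C/|x′| resp. far-field decay) but NOT verbatim for the abstract ancient class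
with only the TEMPORAL bound and no decay at spatial infinity. Transfer in the Albritton–Barker
class 𝒦 = {𝐈 < ∞} ⊇ A_C (= FarPastLedger, #3), i.e. the reverse direction of AlbrittonBarker2019 Thm
1.1 run inside the symmetry class: if u ≢ 0 on the end, pass to the deeper shift v = u(·−δ) ∈ A_C (δ
≥ −θ, tree `IsTypeIAncientMild.comp_sub_right`; v is axisymmetric about the axis through c on ALL of
t < 0 and nontrivial) and blow DOWN about the axis point, v^{(k)}(t,x) = k·v(k²t, c + kx), k → ∞:
v^{(k)} ∈ -/
@[route_item "route-NavierStokesRegularity-SymmetryModuliCount"]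
def AxisymEndLiouville : Prop :=
  ∀ (C : ℝ) (u : ℝ → EuclideanSpace ℝ (Fin 3) → EuclideanSpace ℝ (Fin 3)), Literature.Analysis.FluidPDE.IsTypeIAncientMild C u → ∀ (c : EuclideanSpace ℝ (Fin 3)) (A : EuclideanSpace ℝ (Fin 3) →L[ℝ] EuclideanSpace ℝ (Fin 3)) (θ : ℝ), (∀ x, inner ℝ (A x) x = 0) → A ≠ 0 → θ ≤ 0 → (∀ t < θ, ∀ x, fderiv ℝ (u t) x (A (x - c)) - A (u t x) = 0) → ∀ t < θ, ∀ x, u t x = 0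

-- `AxisymEndLiouville` holds: proved by `Summit.NavierStokesRegularity.NavierStokesRegularity.Theorems.AxisymEndLiouville_of` @ 2c55acfedbed (its module imports this route file, so no `_holds` link can be stated here).

/-- item stmt-NavierStokesRegularity-0056 · crux · rank 6 · open · by planner
why it might fail: No theorem bounds a blow-up rate from above. Tao's averaged-NS blow-up is Type II (arXiv:1402.0290 p.8 fn.), so abstract methods cannot prove it; KNSS2009 p.4: every axisymmetric singularity is Type II, so Hou's axisymmetric candidate (arXiv:2107.06509), if real, refutes it (= ¬Clay A).
sources: Tao2016AveragedNS, arXiv:1402.0290, KNSS2009, Hou2022PotentiallySingularNS, arXiv:2107.06509, Seregin2012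
If a finite-energy classical solution from a rapidly decaying datum has maximal lifespan T<∞ (no
classical extension past T), then ‖u(t)‖_∞ ≤ C (T−t)^{-1/2} eventually as t↑T (Leray's rate is the
matching lower bound, leray_blowup_rate_top). The hardest and most informative crux: a
counterexample is a Type II singularity, i.e. ¬(Clay A). Known: lower bound c√ν (T−t)^{-1/2} (Leray
1934 §20); L³ must blow up (ESS 2003, Seregin 2012); only triple-log quantitative gain (Tao 2021). -/
@[route_item "route-NavierStokesRegularity-SymmetryModuliCount"]
def NoTypeII : Prop :=
  ∀ (ν T : ℝ), 0 < ν → 0 < T → ∀ (u : ℝ → EuclideanSpace ℝ (Fin 3) → EuclideanSpace ℝ (Fin 3)) (p : ℝ → EuclideanSpace ℝ (Fin 3) → ℝ), Literature.Analysis.FluidPDE.IsMaximalSmoothSolution ν 0 u p T → Literature.Analysis.FluidPDE.IsLerayHopfOn T ν 0 (u 0) u → Literature.Analysis.FluidPDE.HasRapidSpatialDecay (u 0) → Literature.Analysis.FluidPDE.IsTypeIBlowup u T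

/-- item stmt-NavierStokesRegularity-14062 · crux · rank 7 · closed · proved by Summit.NavierStokesRegularity.NavierStokesRegularity.Theorems.symmetryModuliCount_helicalEndLiouville_proof @ 2bd2ef5c3e2c (prover) · by planner
why it might fail: Needs KNSS-type compactness + mild closure of A_C under recentred zoom-outs and rotation covariance of the Oseen class (tree pieces, not yet assembled); a z-periodic or helical nonzero Type-I ancient mild solution (none known; cf. LeiRenZhang2019 Thm 1.1, LeiRenZhang2021 on ℝ²×𝕋) refutes it and X.
sources: KNSS2009, arXiv:0709.3599, LeiRenZhang2019, arXiv:1902.11229, LeiRenZhang2021, arXiv:1911.01571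
[crux] Helical / translational (= periodic) leaf on a backward END: if u ∈ A_C (IsTypeIAncientMild C
u) is annihilated on t < θ (θ ≤ 0) by a Killing generator (a + Ax)·∇ − A with A skew and a ∉ range A
— a translation (A = 0, a ≠ 0) or a screw motion of NONZERO pitch — then u ≡ 0 on t < θ. NEW
theorem, closable from tree facts: (1) screw ⊃ lattice (S): skew A ≠ 0 on ℝ³ has spectrum {0, ±iρ},
e^{(2π/ρ)A} = I, and the screw flow over one turn is the translation by L = (2π/ρ)·P_{ker A}a ≠ 0 (a
∉ range A = (ker A)^⊥; L = a if A = 0), so u(t, x+L) = u(t, x) on the end; (2) PeriodicEndLiouville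
(M): if M := limsup_{t→−∞} √(−t)‖u(t)‖∞ > 0, recentre at near-maximisers (t_n → −∞, x_n) and zoom
OUT, v_n(s,y) = λ_n u(λ_n²s, x_n + λ_n y), λ_n = √(−t_n): v_n ∈ A_C (same C), |v_n(−1,0)| ≥ M/2 at
the INTERIOR time s = −1 (no vertex problem), period L/λ_n → 0; KNSS compactness of A_C (uniform
bounds on s < −δ, Lemma 6.1-type, mild closure by dominated convergence in the Oseen term) gives a
C_loc-limit w ∈ A_C invariant under ALL translations along L and nonzero at (−1,0), contradicting
the PROVED tree theorem `KNSS2009_typeI_rate_liouville_holds` (applied to the bounded shift w(·−δ)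
after rotating -/
@[route_item "route-NavierStokesRegularity-SymmetryModuliCount"]
def HelicalEndLiouville : Prop :=
  ∀ (C : ℝ) (u : ℝ → EuclideanSpace ℝ (Fin 3) → EuclideanSpace ℝ (Fin 3)), Literature.Analysis.FluidPDE.IsTypeIAncientMild C u → ∀ (a : EuclideanSpace ℝ (Fin 3)) (A : EuclideanSpace ℝ (Fin 3) →L[ℝ] EuclideanSpace ℝ (Fin 3)) (θ : ℝ), (∀ x, inner ℝ (A x) x = 0) → a ∉ Set.range A → θ ≤ 0 → (∀ t < θ, ∀ x, fderiv ℝ (u t) x (a + A x) - A (u t x) = 0) → ∀ t < θ, ∀ x, u t x = 0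

-- `HelicalEndLiouville` holds: proved by `Summit.NavierStokesRegularity.NavierStokesRegularity.Theorems.symmetryModuliCount_helicalEndLiouville_proof` @ 2bd2ef5c3e2c (its module imports this route file, so no `_holds` link can be stated here).

/-- item stmt-NavierStokesRegularity-4054 · support · rank 4 · open · by planner
why it might fail: Around a nontrivial symmetry-free u the 7 Jacobi fields ARE independent, so this is as strong as non-existence; for GENERAL Type-I drifts the bound is expected false (many unstable modes of the linearised Leray operator at large C), so a proof must use that u solves NS.
sources: ColdingMinicozzi2021, arXiv:1902.01736, KNSS2009, DoeringGibbon1995, EscauriazaSereginSverak2003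
[crux] Linear Liouville for symmetry Jacobi fields (the card's infinitesimal form 'dim{tempered
ancient solutions of the linearisation} ≤ 6'): around any u in A_C := {u smooth on (-inf,0)xR^3,
div-free, KNSS-mild (Oseen integral equation u(t)(x) = heatFlow(u(s))(t-s)(x) - ∫_{τ∈(s,t)} ∫_y
oseenKernel (t-τ) (x-y) (u τ y) (u τ y) for all s<t<0, i.e. u(t) = e^{(t-s)Δ}u(s) - oseenDuhamel 1 s
u u t of NSBoundedMildOseen.lean written out with the in-tree oseenKernel: the gauge without
parasitic b(t) / time-dependent Galilean frames; KNSS2009 §1 (1.7)-(1.9), Seregin2014Notes Def 6.3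
p.109, p.113), HasTypeITimeDecay C u (|u| <= C/sqrt(-t))}, any seven tempered classical solutions
(v_i, q_i) of the linearised system ∂_t v − Δv + (u·∇)v + (v·∇)u + ∇q = 0, div v = 0 on (−∞,0)×R^3 —
tempered := |v| ≤ K(1/√(−t) + (1+|x|)/(−t)), |q| ≤ K(1/(−t) + (1+|x|)/(−t)^{3/2}), the growth of the
7 Jacobi fields ∂_i u, (Ax)·∇u − Au, u + x·∇u + 2t∂_t u and their pressures — admit a nontrivial
combination that is spatially constant on every slice (the parasitic linear modes v = b(t), q =
−b'·x cannot be excluded by growth; affine modes M(t)x are excluded by the pressure growth and t →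
−∞). With JacobiFieldsTemp -/
@[route_item "route-NavierStokesRegularity-SymmetryModuliCount"]
def LinearLiouvilleSeven : Prop :=
  ∀ (C : ℝ) (u : ℝ → EuclideanSpace ℝ (Fin 3) → EuclideanSpace ℝ (Fin 3)), ContDiffOn ℝ (⊤ : ℕ∞) (Function.uncurry u) (Set.Iio 0 ×ˢ Set.univ) ∧ (∀ t < 0, Literature.Analysis.FluidPDE.VectorCalculus.IsDivFree (u t)) ∧ (∀ s t : ℝ, s < t → t < 0 → ∀ x, u t x = Literature.Analysis.FluidPDE.heatFlow (u s) (t - s) x - ∫ τ in Set.Ioo s t, ∫ y, Literature.Analysis.FluidPDE.oseenKernel (t - τ) (x - y) (u τ y) (u τ y)) ∧ Literature.Analysis.FluidPDE.HasTypeITimeDecay C u → ∀ (v : Fin 7 → ℝ → EuclideanSpace ℝ (Fin 3) → EuclideanSpace ℝ (Fin 3)) (q : Fin 7 → ℝ → EuclideanSpace ℝ (Fin 3) → ℝ), (∀ i, (ContDiffOn ℝ (⊤ : ℕ∞) (Function.uncurry (v i)) (Set.Iio 0 ×ˢ Set.univ) ∧ ContDiffOn ℝ (⊤ : ℕ∞)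 (Function.uncurry (q i)) (Set.Iio 0 ×ˢ Set.univ) ∧ (∃ K : ℝ, ∀ t < 0, ∀ x, ‖(v i) t x‖ ≤ K / Real.sqrt (-t) + K * (1 + ‖x‖) / (-t) ∧ |(q i) t x| ≤ K / (-t) + K * (1 + ‖x‖) / Real.sqrt (-t) ^ 3) ∧ (∀ t < 0, Literature.Analysis.FluidPDE.VectorCalculus.IsDivFree ((v i) t)) ∧ (∀ t < 0, ∀ x, Literature.Analysis.FluidPDE.timeDeriv (v i) t x + Literature.Analysis.FluidPDE.convect (u t) ((v i) t) x + Literature.Analysis.FluidPDE.convect ((v i) t) (u t) x = Laplacian.laplacian ((v i) t) x - gradient ((q i) t) x))) → ∃ c : Fin 7 → ℝ, c ≠ 0 ∧ ∀ t < 0, ∃ b : EuclideanSpace ℝ (Fin 3), ∀ x, ∑ i, c i • v i t x = b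

/-- item stmt-NavierStokesRegularity-14063 · support · rank 9 · closed · proved by Summit.NavierStokesRegularity.NavierStokesRegularity.Theorems.symmetryModuliCount_rigidComotionVanishesOnEnd_proof @ 8df1269fd09c (prover) · by planner
[support; elementary, S–M] Rigid co-motion is fatal on a backward end: if u ∈ A_C
(IsTypeIAncientMild C u) is annihilated on t < θ (θ ≤ 0) by the extended generator τ∂_t + (a + Ax)·∇
− A with τ ≠ 0 and A skew — u is a rotating / travelling wave on the end, or steady if (a, A) = 0 —
then u ≡ 0 on t < θ. Proof: the symmetry integrates to u(t + τs, ·) = e^{sA}·u(t, Φ_{−s}(·)) with Φ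
the rigid screw flow of x ↦ a + Ax and e^{sA} orthogonal, so t ↦ ‖u(t)‖∞ is constant on the end,
while ‖u(t)‖∞ ≤ C/√(−t) → 0 as t → −∞. Degenerate cases (τ of either sign, A = 0, a = 0) included.
Hypothesis of `closes`: the case 'both scaling rates nonzero' of the time-anchor collapse, where
σ₁ξ₀ − σ₀ξ₁′ is Killing with τ = −2σ₀σ₁ ≠ 0 (PineauVicol2026 arXiv:2607.09619 Rem 1.8: the Killing
solitons of NS; here they die by the Type-I rate alone). [sources: PineauVicol2026 Rem 1.8;
Cruxes/ForcedSymmetry/Ideator2Sketch.lean `RigidComotionVanishesOnEnd`; triage r1-1/2/3] [deps: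
none] [difficulty: S–M] -/
@[route_item "route-NavierStokesRegularity-SymmetryModuliCount"]
def RigidComotionVanishesOnEnd : Prop :=
  ∀ (C : ℝ) (u : ℝ → EuclideanSpace ℝ (Fin 3) → EuclideanSpace ℝ (Fin 3)), Literature.Analysis.FluidPDE.IsTypeIAncientMild C u → ∀ (a : EuclideanSpace ℝ (Fin 3)) (A : EuclideanSpace ℝ (Fin 3) →L[ℝ] EuclideanSpace ℝ (Fin 3)) (τ θ : ℝ), (∀ x, inner ℝ (A x) x = 0) → τ ≠ 0 → θ ≤ 0 → (∀ t < θ, ∀ x, fderiv ℝ (u t) x (a + A x) + τ • Literature.Analysis.FluidPDE.timeDeriv u t x - A (u t x) = 0) → ∀ t < θ, ∀ x, u t x = 0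

-- `RigidComotionVanishesOnEnd` holds: proved by `Summit.NavierStokesRegularity.NavierStokesRegularity.Theorems.symmetryModuliCount_rigidComotionVanishesOnEnd_proof` @ 8df1269fd09c (its module imports this route file, so no `_holds` link can be stated here).

/-- item stmt-NavierStokesRegularity-14064 · support · rank 9 · closed · proved by Summit.NavierStokesRegularity.NavierStokesRegularity.Theorems.symmetryModuliCount_backwardEndVanishing_proof @ 80f89d16c731 (prover) · by planner
[support; folklore, S–M] Vanishing on a backward end propagates forward: if u ∈ A_C
(IsTypeIAncientMild C u) vanishes on t < θ for some θ ≤ 0 then u ≡ 0 on all of t < 0. Proof: for θ ≤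
t < t′ < 0 the field is bounded by C/√(−t′) and satisfies the Oseen integral equation from every s <
θ with zero data, so ‖u(t)‖∞ ≤ c∫_θ^t (t−τ)^{-1/2}‖u(τ)‖∞²dτ ≤ c·(C/√(−t′))·∫_θ^t
(t−τ)^{-1/2}‖u(τ)‖∞dτ and a singular Gronwall / short-step iteration gives u ≡ 0 on [θ, t′] (forward
uniqueness of bounded mild solutions: KNSS2009 §4 'u = U + B(u,u) … as an ODE in t', arXiv:0709.3599
p.8; tree `oseenMild_restart`, `oseenDuhamel` bounds of NSBoundedMildOseen). Hypothesis of `closes`.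
[sources: KNSS2009 §4; Seregin2014Notes Ch.6] [deps: none] [difficulty: S–M] -/
@[route_item "route-NavierStokesRegularity-SymmetryModuliCount"]
def BackwardEndVanishing : Prop :=
  ∀ (C : ℝ) (u : ℝ → EuclideanSpace ℝ (Fin 3) → EuclideanSpace ℝ (Fin 3)), Literature.Analysis.FluidPDE.IsTypeIAncientMild C u → ∀ θ : ℝ, θ ≤ 0 → (∀ t < θ, ∀ x, u t x = 0) → ∀ t < 0, ∀ x, u t x = 0

-- `BackwardEndVanishing` holds: proved by `Summit.NavierStokesRegularity.NavierStokesRegularity.Theorems.symmetryModuliCount_backwardEndVanishing_proof` @ 80f89d16c731 (its module imports this route file, so no `_holds` link can be stated here).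

/-- item stmt-NavierStokesRegularity-14340 · support · rank 9 · closed · proved by Summit.NavierStokesRegularity.NavierStokesRegularity.Theorems.symmetryModuliCount_stretchingCertificateComparison_proof @ 2ab79c0e085f (prover) · by planner
[support; NEW theorem, M–L, provable now; lever C engine] CERTIFICATE COMPARISON: an element of A_C
that admits a stretching certificate (δ, A, h as in UniversalStretchingCertificate) vanishes
identically. Proof on file as the checked skeleton
Cruxes/LinearLiouvilleSeven/Lines/vortex-stretching-wall.lean (stubs stub_simGradientBound S–M,
stub_katoSimilarityIdentity M, stub_certificateComparison M–L; composition kernel-checked; line card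
Lines/vortex-stretching-wall.md; triage r1-1 §B / r1-3 re-derived every identity, j009937:E,F): Θ =
(−t)|ω| obeys off {ω = 0} the exact pressure-blind identity (∂ₜ + u·∇ − Δ)Θ = (Θ/(−t))(w − 1)
(Kato's chain rule + the stretching factor, MajdaBertozzi2002 §5.1 (5.8)–(5.9) p.152; mild ⇒
classical pair and the similarity vorticity equation are the PROVED tree theorems
IsTypeIAncientMild.exists_isClassicalNSSolutionOn_Ioo / IsTypeIAncientMild.lerayVorticity_eq; |∇u| ≤
C₁(C)/(−t) from Theorems.exists_norm_iteratedFDeriv_le_of_typeI + isTypeIAncientMild_zoom), so in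
similarity variables Θ ≤ √6·C₁ is a bounded ETERNAL subsolution of ∂ₛ − Δ + (y/2+U)·∇ − (W−1); Ψ =
Θ/H satisfies ∂ₛΨ ≤ ΔΨ − (y/2+U−2∇H/H)·∇Ψ − δΨ on {Ω ≠ 0}, Ψ = 0 on {Ω = 0}; Φ = e^{δs}Ψ is -/
@[route_item "route-NavierStokesRegularity-SymmetryModuliCount"]
def StretchingCertificateComparison : Prop :=
  ∀ (C : ℝ) (u : ℝ → EuclideanSpace ℝ (Fin 3) → EuclideanSpace ℝ (Fin 3)), Literature.Analysis.FluidPDE.IsTypeIAncientMild C u → (∃ (δ A : ℝ) (h : ℝ → EuclideanSpace ℝ (Fin 3) → ℝ), 0 < δ ∧ ContDiffOn ℝ (⊤ : ℕ∞) (Function.uncurry h) (Set.Iio 0 ×ˢ Set.univ) ∧ (∀ t < 0, ∀ x, 1 ≤ h t x ∧ ‖fderiv ℝ (h t) x‖ ≤ A * (1 / Real.sqrt (-t) + ‖x‖ / (-t)) * h t x) ∧ (∀ t < 0, ∀ x, Literature.Analysis.FluidPDE.curl (u t) x ≠ 0 → ((-t) * (inner ℝ (fderiv ℝ (u t) x (Literature.Analysis.FluidPDE.vorticityDirection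 (Literature.Analysis.FluidPDE.curl (u t)) x)) (Literature.Analysis.FluidPDE.vorticityDirection (Literature.Analysis.FluidPDE.curl (u t)) x) - Literature.Analysis.FluidPDE.frobeniusNormSq (fderiv ℝ (Literature.Analysis.FluidPDE.vorticityDirection (Literature.Analysis.FluidPDE.curl (u t))) x)) - 1 + δ) * h t x ≤ (-t) * (Literature.Analysis.FluidPDE.timeDeriv h t x + fderiv ℝ (h t) x (u t x) - Laplacian.laplacian (h t) x))) → ∀ t < 0, ∀ x, u t x = 0

-- `StretchingCertificateComparison` holds: proved by `Summit.NavierStokesRegularity.NavierStokesRegularity.Theorems.symmetryModuliCount_stretchingCertificateComparison_proof` @ 2ab79c0e085f (its module imports this route file, so no `_holds` link can be stated here).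

/-- item stmt-NavierStokesRegularity-14736 · support · rank 9 · closed · proved by Summit.NavierStokesRegularity.NavierStokesRegularity.Theorems.symmetryModuliCount_axisymEndLiouvilleOfFarPastLedger_proof @ 9ff00b0b8e29 (prover) · by planner
[support; glue, M–L] LEDGER ⇒ AXISYMMETRIC LEAF: FarPastLedger → AxisymEndLiouville. Connects crux
#3 (stmt-NavierStokesRegularity-14060) to the `closes` hypothesis hA
(stmt-NavierStokesRegularity-14061): this is the route's stated plan for the axisymmetric leaf
(header RANKED CRUXES #4: 'known in 𝒦 after #3'); with it hA has two ways in — direct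
(Cruxes/AxisymEndLiouville, lead line absorbing-axis-swirl-extinction) or #3 + this item. Proof
plan: let u ∈ A_C be annihilated on t < θ (θ ≤ 0) by the rotations about the axis through c (skew A
≠ 0) and suppose u ≢ 0 there; the backward shift v = u(· − (−θ)) ∈ A_C
(IsTypeIAncientMild.comp_sub_right) is axisymmetric about that axis on ALL t < 0 and nonzero.
FarPastLedger gives sup_{t,x₀,R} R⁻¹∫_{B_R(x₀)}|v(t)|² ≤ K(C), a scale-invariant bound, so every
blow-down v_k(t,x) = k·v(k²t, c + kx), k → ∞ (Theorems.isTypeIAncientMild_zoom + translation) lies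
in A_C with the same ledger constant, hence in Albritton–Barker's class 𝒦 uniformly (velocity part ≤
K; C(Q_r) ≤ 2CK from |v|³ ≤ ‖v‖∞|v|²; pressure/dissipation parts from the local energy inequality +
Calderón–Zygmund for the Oseen pressure). Compactness in 𝒦 (Theorems.exists_tendsto_of_isType -/
@[route_item "route-NavierStokesRegularity-SymmetryModuliCount"]
def AxisymEndLiouvilleOfFarPastLedger : Prop :=
  FarPastLedger → AxisymEndLiouville

-- `AxisymEndLiouvilleOfFarPastLedger` holds: proved by `Summit.NavierStokesRegularity.NavierStokesRegularity.Theorems.symmetryModuliCount_axisymEndLiouvilleOfFarPastLedger_proof` @ 9ff00b0b8e29 (its module imports this route file, so no `_holds` link can be stated here).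

/-- item stmt-NavierStokesRegularity-14740 · support · rank 9 · closed · proved by Summit.NavierStokesRegularity.NavierStokesRegularity.Theorems.symmetryModuliCount_helicalEndLiouvilleOfSymmetricLiouville_proof (prover) · by planner
[support; glue, S — pure logic + the backward time-shift invariance of A_C; PROOF ON FILE]
SymmetricLiouville → HelicalEndLiouville. Connects crux stmt-NavierStokesRegularity-4053 (the rev-1
discrete-stabiliser Liouville statement: an element of A_C annihilated on the WHOLE past by a
nonzero generator of sim(3) vanishes) to the `closes` hypothesis hH
(stmt-NavierStokesRegularity-14062). Proof (kernel-checked in the planner's Sketch.lean,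
`helicalEndLiouvilleOfSymmetricLiouville_proof`, lean check rc0 / 0 sorry, attached as evidence — an
idle prover lands it verbatim): given u ∈ A_C (IsTypeIAncientMild C u) annihilated on t < θ (θ ≤ 0)
by the Killing generator (a + Ax)·∇ − A with A skew and a ∉ range A, the backward shift v = fun s =>
u (s − (−θ)) lies in A_C (IsTypeIAncientMild.comp_sub_right with δ = −θ ≥ 0) and is annihilated on
all s < 0 by the same generator, which is the σ = 0 row of SymmetricLiouville's clause (the terms
0•x, 0•u, (2·0·s)•timeDeriv vanish by simp; (a, 0, A) ≠ 0 because a ∉ range A ∋ 0);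
SymmetricLiouville (fed through isTypeIAncientMild_iff) gives v ≡ 0 on s < 0, and u t x = v (t +
(−θ)) x = 0 for t < θ. WHY SymmetricLiouville IS KEPT AND GLUED rather than dr -/
@[route_item "route-NavierStokesRegularity-SymmetryModuliCount"]
def HelicalEndLiouvilleOfSymmetricLiouville : Prop :=
  SymmetricLiouville → HelicalEndLiouville

-- `HelicalEndLiouvilleOfSymmetricLiouville` holds: proved by `Summit.NavierStokesRegularity.NavierStokesRegularity.Theorems.symmetryModuliCount_helicalEndLiouvilleOfSymmetricLiouville_proof` (its module imports this route file, so no `_holds` link can be stated here).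

/-- item stmt-NavierStokesRegularity-4056 · support · rank 9 · closed · proved by Summit.NavierStokesRegularity.NavierStokesRegularity.Theorems.symmetryModuliCount_liouvilleKillsTypeI_proof (prover) · by planner
sources: KNSS2009, SereginSverak2009, Seregin2014Notes, AlbrittonBarker2019
[support, glue in the assembly; KNOWN argument] X ⇒ a finite-energy classical solution (u,p) on
[0,T) from a rapidly decaying datum with Type-I rate ‖u(t)‖_∞ ≤ C(T−t)^{-1/2} near T extends
smoothly past T. Proof (KNSS2009 §6 Prop 6.1 + Lemma 6.1; SereginSverak2009 §4; Seregin2014Notes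
Prop 3.10-3.11 pp.111-114; AlbrittonBarker2019 §3): if not, u is unbounded near T (continuation fact
hasSmoothExtensionPast_of_bounded, KNSSTypeII.lean); zoom at near-maxima, u_k(s,y) = M_k^{-1} u(t_k
+ s/M_k², x_k + y/M_k), M_k = sup_{t≤t_k}‖u‖_∞ → ∞: |u_k| ≤ 1 on s ≤ 0, |u_k(0,0)| ≥ 1/2, and the
Type-I rate gives |u_k(s,·)| ≤ C/√(M_k²(T−t_k) − s) ≤ C/√(−s) with the SAME C; KNSS Prop 4.1 bounds
(fact knss2009_smoothing) + Arzelà–Ascoli give a C^∞_loc limit ū on (−∞,0]×R^3 which is div-free,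
satisfies the Oseen integral equation (dominated convergence in oseenDuhamel; kernel bound (14)),
HasTypeITimeDecay C, and |ū(0,0)| ≥ 1/2; X forces ū ≡ 0 on s < 0, contradicting continuity at s = 0.
May take the named facts knss2009_smoothing / hasSmoothExtensionPast_of_bounded as hypotheses if the
grounder so rules. Its (L)-version is stmt-NavierStokesRegularity-0058. [sources: KNSS2009 §6;
SereginSverak2009 §4; -/
@[route_item "route-NavierStokesRegularity-SymmetryModuliCount"]
def LiouvilleKillsTypeI : Prop :=
  (∀ (C : ℝ) (u : ℝ → EuclideanSpace ℝ (Fin 3) → EuclideanSpace ℝ (Fin 3)), ContDiffOn ℝ (⊤ : ℕ∞) (Function.uncurry u) (Set.Iio 0 ×ˢ Set.univ) ∧ (∀ t < 0, Literature.Analysis.FluidPDE.VectorCalculus.IsDivFree (u t)) ∧ (∀ s t : ℝ, s < t → t < 0 → ∀ x, u t x = Literature.Analysis.FluidPDE.heatFlow (u s) (t - s) x - ∫ τ in Set.Ioo s t, ∫ y, Literature.Analysis.FluidPDE.oseenKernel (t - τ) (x - y) (u τ y) (u τ y)) ∧ Literature.Analysis.FluidPDE.HasTypeITimeDecay C u →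 ∀ t < 0, ∀ x, u t x = 0) → ∀ (ν T : ℝ), 0 < ν → 0 < T → ∀ (u : ℝ → EuclideanSpace ℝ (Fin 3) → EuclideanSpace ℝ (Fin 3)) (p : ℝ → EuclideanSpace ℝ (Fin 3) → ℝ), Literature.Analysis.FluidPDE.IsClassicalNSSolutionOn (Set.Ico 0 T) ν 0 u p → Literature.Analysis.FluidPDE.IsLerayHopfOn T ν 0 (u 0) u → Literature.Analysis.FluidPDE.HasRapidSpatialDecay (u 0) → Literature.Analysis.FluidPDE.IsTypeIBlowup u T → Literature.Analysis.FluidPDE.HasSmoothExtensionPast ν 0 u T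

-- `LiouvilleKillsTypeI` holds: proved by `Summit.NavierStokesRegularity.NavierStokesRegularity.Theorems.symmetryModuliCount_liouvilleKillsTypeI_proof` (its module imports this route file, so no `_holds` link can be stated here).

/-- item stmt-NavierStokesRegularity-4051 · assembly · rank 1 · closed · proved by Summit.NavierStokesRegularity.NavierStokesRegularity.Theorems.symmetryModuliCount_assembly_proof @ 60426a9c56fc (prover) · by planner
sources: KNSS2009, Fefferman2000
[assembly] ForcedSymmetry → SymmetricLiouville → LiouvilleKillsTypeI → NoTypeII → NoBlowupToClay →
NavierStokesRegularity. PURE LOGIC (planner's Sketch.lean `assembly_of_decls`, lean check rc 0, ~10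
lines): ForcedSymmetry hands ξ≠0 with L_ξ u = 0, SymmetricLiouville kills u, so X holds; for a
finite-energy classical solution from Schwartz data on [0,T): if it has no smooth extension it is
maximal (IsMaximalSmoothSolution := classical ∧ ¬HasSmoothExtensionPast), NoTypeII (=
stmt-NavierStokesRegularity-0056) gives the Type-I rate, LiouvilleKillsTypeI with X gives the
extension — contradiction; NoBlowupToClay (= stmt-NavierStokesRegularity-0055) concludes Clay (A).
[sources: Fefferman2000, KNSS2009] -/
@[route_item "route-NavierStokesRegularity-SymmetryModuliCount"]
def Assembly : Prop :=
  (∀ (C : ℝ) (u : ℝ → EuclideanSpace ℝ (Fin 3) → EuclideanSpace ℝ (Fin 3)), ContDiffOn ℝ (⊤ : ℕ∞) (Function.uncurry u) (Set.Iio 0 ×ˢ Set.univ) ∧ (∀ t < 0, Literature.Analysis.FluidPDE.VectorCalculus.IsDivFree (u t)) ∧ (∀ s t : ℝ, s < t → t < 0 → ∀ x, u t x = Literature.Analysis.FluidPDE.heatFlow (u s) (t - s) x - ∫ τ in Set.Ioo s t, ∫ y, Literature.Analysis.FluidPDE.oseenKernel (t - τ) (x - y) (u τ y) (u τ y)) ∧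 Literature.Analysis.FluidPDE.HasTypeITimeDecay C u → ∃ (a : EuclideanSpace ℝ (Fin 3)) (σ : ℝ) (A : EuclideanSpace ℝ (Fin 3) →L[ℝ] EuclideanSpace ℝ (Fin 3)), (∀ x, inner ℝ (A x) x = 0) ∧ ¬ (a = 0 ∧ σ = 0 ∧ A = 0) ∧ ∀ t < 0, ∀ x, fderiv ℝ (u t) x (a + σ • x + A x) + σ • u t x + (2 * σ * t) • Literature.Analysis.FluidPDE.timeDeriv u t x - A (u t x) = 0) → (∀ (C : ℝ) (u : ℝ → EuclideanSpace ℝ (Fin 3) → EuclideanSpace ℝ (Fin 3)), ContDiffOn ℝ (⊤ : ℕ∞) (Function.uncurry u) (Set.Iio 0 ×ˢ Set.univ) ∧ (∀ t < 0, Literature.Analysis.FluidPDE.VectorCalculus.IsDivFree (u t)) ∧ (∀ s t : ℝ, s < t → t < 0 → ∀ x, u t x = Literature.Analysis.FluidPDE.heatFlow (u s) (t - s) x - ∫ τ in Set.Ioo s t, ∫ y, Literature.Analysis.FluidPDE.oseenKernel (t - τ) (x - y) (u τ y) (u τ y)) ∧ Literature.Analysis.FluidPDE.HasTypeITimeDecay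 C u → ∀ (a : EuclideanSpace ℝ (Fin 3)) (σ : ℝ) (A : EuclideanSpace ℝ (Fin 3) →L[ℝ] EuclideanSpace ℝ (Fin 3)), (∀ x, inner ℝ (A x) x = 0) → ¬ (a = 0 ∧ σ = 0 ∧ A = 0) → (∀ t < 0, ∀ x, fderiv ℝ (u t) x (a + σ • x + A x) + σ • u t x + (2 * σ * t) • Literature.Analysis.FluidPDE.timeDeriv u t x - A (u t x) = 0) → ∀ t < 0, ∀ x, u t x = 0) → ((∀ (C : ℝ) (u : ℝ → EuclideanSpace ℝ (Fin 3) → EuclideanSpace ℝ (Fin 3)), ContDiffOn ℝ (⊤ : ℕ∞) (Function.uncurry u) (Set.Iio 0 ×ˢ Set.univ) ∧ (∀ t < 0, Literature.Analysis.FluidPDE.VectorCalculus.IsDivFree (u t)) ∧ (∀ s t : ℝ, s < t → t < 0 → ∀ x, u t x = Literature.Analysis.FluidPDE.heatFlow (u s) (t - s) x - ∫ τ in Set.Ioo s t, ∫ y, Literature.Analysis.FluidPDE.oseenKernel (t - τ) (x - y) (u τ y) (u τ y)) ∧ Literature.Analysis.FluidPDE.HasTypeITimeDecay C u → ∀ t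 < 0, ∀ x, u t x = 0) → ∀ (ν T : ℝ), 0 < ν → 0 < T → ∀ (u : ℝ → EuclideanSpace ℝ (Fin 3) → EuclideanSpace ℝ (Fin 3)) (p : ℝ → EuclideanSpace ℝ (Fin 3) → ℝ), Literature.Analysis.FluidPDE.IsClassicalNSSolutionOn (Set.Ico 0 T) ν 0 u p → Literature.Analysis.FluidPDE.IsLerayHopfOn T ν 0 (u 0) u → Literature.Analysis.FluidPDE.HasRapidSpatialDecay (u 0) → Literature.Analysis.FluidPDE.IsTypeIBlowup u T → Literature.Analysis.FluidPDE.HasSmoothExtensionPast ν 0 u T) → (∀ (ν T : ℝ), 0 < ν → 0 < T → ∀ (u : ℝ → EuclideanSpace ℝ (Fin 3) → EuclideanSpace ℝ (Fin 3)) (p : ℝ → EuclideanSpace ℝ (Fin 3) → ℝ), Literature.Analysis.FluidPDE.IsMaximalSmoothSolution ν 0 u p T → Literature.Analysis.FluidPDE.IsLerayHopfOn T ν 0 (u 0) u → Literature.Analysis.FluidPDE.HasRapidSpatialDecay (u 0) → Literature.Analysis.FluidPDE.IsTypeIBlowup u T) → ((∀ (ν T : ℝ), 0 < ν → 0 < T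 → ∀ (u : ℝ → EuclideanSpace ℝ (Fin 3) → EuclideanSpace ℝ (Fin 3)) (p : ℝ → EuclideanSpace ℝ (Fin 3) → ℝ), Literature.Analysis.FluidPDE.IsClassicalNSSolutionOn (Set.Ico 0 T) ν 0 u p → Literature.Analysis.FluidPDE.IsLerayHopfOn T ν 0 (u 0) u → Literature.Analysis.FluidPDE.HasRapidSpatialDecay (u 0) → Literature.Analysis.FluidPDE.HasSmoothExtensionPast ν 0 u T) → NavierStokesRegularity) → NavierStokesRegularity

-- `Assembly` holds: proved by `Summit.NavierStokesRegularity.NavierStokesRegularity.Theorems.symmetryModuliCount_assembly_proof` @ 60426a9c56fc (its module imports this route file, so no `_holds` link can be stated here).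

-- records of items no longer active in this route (dropped / restated):
-- earlier NoBlowupToClay (stmt-NavierStokesRegularity-0055, dropped 2026-08-16T06:34:05Z): proved by Summit.NavierStokesRegularity.NavierStokesRegularity.Theorems.typeICertificateLadder_noBlowupToClay_proof @ 8d57e70af7e2 — (∀ (ν T : ℝ), 0 < ν → 0 < T → ∀ (u : ℝ → EuclideanSpace ℝ (Fin 3) → EuclideanSpace ℝ (Fin 3)) (p : ℝ → EuclideanSpace ℝ (Fin 3) → ℝ), Literature.Analysis.FluidPDE.IsClassicalNSSo
-- earlier FiniteTangentModuli (stmt-NavierStokesRegularity-4055, dropped 2026-08-16T01:32:49Z): refuted by Summit.NavierStokesRegularity.NavierStokesRegularity.Theorems.SymmetryModuliCountFiniteTangentModuli_refuted — ∀ (C : ℝ) (u : ℝ → EuclideanSpace ℝ (Fin 3) → EuclideanSpace ℝ (Fin 3)), ContDiffOn ℝ (⊤ : ℕ∞) (Function.uncurry u) (Set.Iio 0 ×ˢ Set.univ) → (∀ t < 0, Literature.Analysis.FluidPDE.Vec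

/-! D-0027 §2.1 — DECIDING THEOREM (planner-authored via `route open/edit --closes-file`; by planner-rrepair-NavierStokesRegularity-Symmetr-6deee1c1-0 2026-08-16T06:34:05Z):
its hypotheses are this route's items and its conclusion the sub-problem Statement (glue_lint), and it elaborates with this file. -/

@[closes "route-NavierStokesRegularity-SymmetryModuliCount"] theorem closes (hF : ForcedSymmetry) (hR : RigidComotionVanishesOnEnd) (hH : HelicalEndLiouville)
    (hA : AxisymEndLiouville) (hB : BackwardEndVanishing) (hK : LiouvilleKillsTypeI)
    (hII : NoTypeII) : NavierStokesRegularity := by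
  -- Step 0: the Killing leaf on a backward end = helical/periodic leaf (hH) + axisymmetric leaf (hA),
  -- split on whether the translation part lies in the range of the rotation part.
  have hKill : ∀ (C : ℝ) (u : ℝ → EuclideanSpace ℝ (Fin 3) → EuclideanSpace ℝ (Fin 3)),
      Literature.Analysis.FluidPDE.IsTypeIAncientMild C u →
      ∀ (a : EuclideanSpace ℝ (Fin 3)) (A : EuclideanSpace ℝ (Fin 3) →L[ℝ] EuclideanSpace ℝ (Fin 3)) (θ : ℝ),
        (∀ x, inner ℝ (A x) x = 0) → ¬ (a = 0 ∧ A = 0) → θ ≤ 0 →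
        (∀ t < θ, ∀ x, fderiv ℝ (u t) x (a + A x) - A (u t x) = 0) → ∀ t < θ, ∀ x, u t x = 0 := by
    intro C u hu a A θ hAs hne hθ hsym
    by_cases hr : a ∈ Set.range A
    · obtain ⟨c', hc'⟩ := hr
      have hA0 : A ≠ 0 := by
        rintro rfl
        exact hne ⟨by simpa using hc'.symm, rfl⟩
      refine hA C u hu (-c') A θ hAs hA0 hθ ?_
      intro t ht x
      have key := hsym t ht x
      have e : A (x - -c') = a + A x := by
        rw [map_sub, map_neg, hc']; abel
      rw [e]
      exact key
    · exact hH C u hu a A θ hAs hr hθ hsym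
  -- Step 1: X = TypeIAncientLiouville from ForcedSymmetry by the time-anchor bootstrap.
  have hX : TypeIAncientLiouville := by
    intro C u hu
    have hu' : Literature.Analysis.FluidPDE.IsTypeIAncientMild C u :=
      Literature.Analysis.FluidPDE.isTypeIAncientMild_iff.2 hu
    have hshift : Literature.Analysis.FluidPDE.IsTypeIAncientMild C (fun t => u (t - 1)) :=
      hu'.comp_sub_right zero_le_one
    obtain ⟨a₀, σ₀, A₀, hA₀, hne₀, h₀⟩ := hF C u hu
    obtain ⟨a₁, σ₁, A₁, hA₁, hne₁, h₁⟩ :=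
      hF C (fun t => u (t - 1)) (Literature.Analysis.FluidPDE.isTypeIAncientMild_iff.1 hshift)
    -- transport the generator of the shifted field to a generator of `u` anchored at `t = -1`
    have h₁' : ∀ t < (-1 : ℝ), ∀ x, fderiv ℝ (u t) x (a₁ + σ₁ • x + A₁ x) + σ₁ • u t x
        + (2 * σ₁ * t + 2 * σ₁) • Literature.Analysis.FluidPDE.timeDeriv u t x - A₁ (u t x) = 0 := by
      intro t ht x
      have key := h₁ (t + 1) (by linarith) x
      have hd : Literature.Analysis.FluidPDE.timeDeriv (fun s => u (s - 1)) (t + 1) x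
          = Literature.Analysis.FluidPDE.timeDeriv u t x := by
        simp only [Literature.Analysis.FluidPDE.timeDeriv_apply]
        rw [deriv_comp_sub_const (f := fun s => u s x) (a := (1 : ℝ)) (x := t + 1)]
        simp
      simp only [hd, add_sub_cancel_right] at key
      have hc : (2 * σ₁ * (t + 1)) = 2 * σ₁ * t + 2 * σ₁ := by ring
      rw [hc] at key
      exact key
    apply hB C u hu' (-1) (by norm_num)
    by_cases hσ₀ : σ₀ = 0
    · subst hσ₀
      have hne : ¬ (a₀ = 0 ∧ A₀ = 0) := fun h => hne₀ ⟨h.1, rfl, h.2⟩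
      refine hKill C u hu' a₀ A₀ (-1) hA₀ hne (by norm_num) ?_
      intro t ht x
      have := h₀ t (by linarith) x
      simpa using this
    by_cases hσ₁ : σ₁ = 0
    · subst hσ₁
      have hne : ¬ (a₁ = 0 ∧ A₁ = 0) := fun h => hne₁ ⟨h.1, rfl, h.2⟩
      refine hKill C u hu' a₁ A₁ (-1) hA₁ hne (by norm_num) ?_
      intro t ht x
      have := h₁' t ht x
      simpa using this
    -- both scaling rates nonzero: subtract the two anchored generators → rigid co-motion, τ = -2σ₀σ₁ ≠ 0
    refine hR C u hu' (σ₁ • a₀ - σ₀ • a₁) (σ₁ • A₀ - σ₀ • A₁) (-(2 * σ₀ * σ₁)) (-1) ?_ ?_ (by norm_num) ?_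
    · intro x
      simp [inner_sub_left, inner_smul_left, hA₀ x, hA₁ x]
    · have : σ₀ * σ₁ ≠ 0 := mul_ne_zero hσ₀ hσ₁
      intro h
      apply this
      linarith
    · intro t ht x
      have k₀ := h₀ t (by linarith) x
      have k₁ := h₁' t ht x
      simp only [map_add, map_smul, _root_.sub_apply, _root_.smul_apply, map_sub] at k₀ k₁ ⊢
      linear_combination (norm := module) σ₁ • k₀ - σ₀ • k₁
  -- Step 2 (known tail): the PROVED shared frame theorem `NoBlowupToClay` (item
  -- stmt-NavierStokesRegularity-0055, closed by `typeICertificateLadder_noBlowupToClay_proof`, cited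
  -- here as a tree theorem rather than carried as a hypothesis) reduces Clay (A) to continuation
  -- past every T; a maximal solution is Type I by NoTypeII and then extends by LiouvilleKillsTypeI
  -- with X — contradiction.
  apply _root_.Summit.NavierStokesRegularity.NavierStokesRegularity.Theorems.typeICertificateLadder_noBlowupToClay_proof
  intro ν T hν hT u p hcl hLH hdec
  by_contra hext
  exact hext (hK hX ν T hν hT u p hcl hLH hdec (hII ν T hν hT u p ⟨hcl, hext⟩ hLH hdec))

end Summit.NavierStokesRegularity.NavierStokesRegularity.Theses.SymmetryModuliCount
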